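import Summits.CriticalPhenomena.Ising3DConformalLimit.Theorems.FKParityRobustnessIndependentStrandsJoinCrossFatteningDefs
import Summits.CriticalPhenomena.Ising3DConformalLimit.Theorems.FKParityRobustnessLatticeBoundFromStrands
import Summits.CriticalPhenomena.Ising3DConformalLimit.Theorems.FKParityRobustnessStrandsJoinBound
import Literature.Probability.LatticeModels.CurrentsPartialMonotonicity
import HarnessLib

/-!
# Crux `IndependentStrandsJoin` (stmt-CriticalPhenomena-14625), line `cross-fattening-decoupling` —
# stub `stub_crossPairTree`, step (iii): the Aizenman–Duminil-Copin pair tree bound in loop-O(1) clothes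

Route `FKParityRobustness`, sub-problem `Ising3DConformalLimit`; `--supports` file of the registered stub
`stub_crossPairTree` (skeleton `Cruxes/IndependentStrandsJoin/Lines/cross_fattening_decoupling.lean`), over the
line's landed vocabulary `Theorems/FKParityRobustnessIndependentStrandsJoinCrossFatteningDefs.lean`
(`rch`, `zPair`, `treePair`).  Companion of `…StubCrossPairTreeFactorisation.lean` (step (i), the pair
factorisation identity `crossMomentSq_eq_clusterSum`).

The stub bounds the second crossed moment `(Z^∅)⁴ · crossMomentSq ≤ C · bubbleSum`,
`bubbleSum = Σ_{v,w ∈ B} treePair(a₀a₁;v,w) · treePair(a₂a₃;v,w)`, and its intended proof is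
(i) pair factorisation (landed) + (ii) hole filling (open, d = 3) + (iii) "the un-depleted crossed cluster
`C(x; F ∪ L')`, `F ~ ℓ^{xy}`, `L' ~ ℓ^∅` independent, sits inside the double-current cluster `𝐂_{n₁+n₂}(x)` of
`P^{xy} ⊗ P^∅`, whose pair connection function obeys ADC2021 Prop. A.3".  THIS FILE PROVES (iii) on every
finite graph, for `β ≥ 0`, `t = tanh β`, `x ≠ y`, `v, w` arbitrary (`pairTree_loopPairSum_le_treePair`):

  `Z^∅_t · Σ_{F ∈ 𝒯(xy)} Σ_{L ∈ 𝒯(∅)} t^{|F|+|L|} 1[x ↝_{F∪L} v ∧ x ↝_{F∪L} w] ≤ treePair G t x y v w`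
  `= Z(xv)Z(vw)Z(wy) + Z(xw)Z(wv)Z(vy)`,   `Z(ab) = Z^{{a}∆{b}}_t = zPair G t a b`,

i.e. `ℓ^{xy}_t ⊗ ℓ^∅_t [v, w ∈ C(x; F ∪ L)] ≤ [⟨σ_xσ_v⟩⟨σ_vσ_w⟩⟨σ_wσ_y⟩ + ⟨σ_xσ_w⟩⟨σ_wσ_v⟩⟨σ_vσ_y⟩] / ⟨σ_xσ_y⟩`
(free b.c., `⟨σ_aσ_b⟩ = Z(ab)/Z^∅`).  With (i) this reduces the stub to the single hole-filling inequality
`(Z^∅)² Σ_{K₁,K₂} t^{|K₁|+|K₂|} A(a₀;K₁|K₂;v,w) A(a₂;K₂|K₁;v,w) ≤ C · S(a₀a₁;v,w) · S(a₂a₃;v,w)` with `S` the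
double sum displayed above (depleted soups `𝓔_∅(G − V(K_j))` against full soups `𝓔_∅(G)`).

Proof.  (1) `pairTree_twoCopyPushforward`: under the pair weight `1{∂n₁ = A}1{∂n₂ = B} w_β w_β` the odd parts
`(odd n₁, odd n₂)` are distributed as `s(F₁)s(F₂)` on `𝒯(A) × 𝒯(B)`, `s(F) = sinh(β)^{|F|}cosh(β)^{|E|−|F|}
= cosh(β)^{|E|} tanh(β)^{|F|}` — twice the landed one-copy pushforward `tsum_sources_eweight_mul_apply_oddPart`
(`Theorems/FKParityRobustnessParityBoundCurrents.lean`; the tree's `twoCopyPushforward` is the indicator case).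
(2) `pairTree_mem_cluster_of_rch_oddPart`: `odd n₁ ∪ odd n₂ ⊆ trace(n₁ + n₂)` (`coe_oddPart_subset_traced_add`),
so `x ↝_{odd n₁ ∪ odd n₂} u ⟹ u ∈ 𝐂_{n₁+n₂}(x)`.  (3) ADC2021 Prop. A.3 as proved in the tree,
`Z[∅] · Σ 1{xy}1{∅} w w 1[v ∈ 𝐂(x)]1[w ∈ 𝐂(x)] ≤ Z[xw]Z[wv]Z[vy] + Z[xv]Z[vw]Z[wy]`
(`Current.ecurrentSum_empty_mul_tsum_double_conn_le`, `Literature/…/CurrentsPartialMonotonicity.lean`).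
(4) The dictionary `Z_β[A] = cosh(β)^{|E|} · Z^A_{tanh β}` (`ecurrentSum_eq_ofReal_loopO1`,
`Theorems/FKParityRobustnessLatticeBoundFromStrands.lean`), cast to `ℝ`, the factor `cosh(β)^{3|E|}` cancelling.

Theorem-only file (no new definitions); helper namespace `…Theorems.StubCrossPairTree` (prefix `pairTree_`).
References: M. Aizenman, H. Duminil-Copin, Ann. of Math. 194 (2021), arXiv:1912.07973, Lemma 4.4 and
Appendix A.2, Prop. A.3 [AizenmanDuminilCopinAnnals2021]; H. Duminil-Copin, arXiv:1607.06933, Remark 3.4 (odd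
part of a current vs. loop O(1)) [DuminilCopin2016]; U. T. Hansen, J. Jiang, F. R. Klausen, arXiv:2506.10765, §2
[HansenJiangKlausen2025]; M. Aizenman, Comm. Math. Phys. 86 (1982), §5 [AizenmanCMP1982].
-/

noncomputable section

open Finset SimpleGraph
open Literature.Probability.LatticeModels
open scoped ENNReal symmDiff

namespace Summit.CriticalPhenomena.Ising3DConformalLimit.Theorems

namespace StubCrossPairTree

open Summit.CriticalPhenomena.Ising3DConformalLimit.Cruxes.IndependentStrandsJoin.CrossFatteningDecoupling
open scoped Classical BigOperators

variable {V : Type*} [Fintype V] [DecidableEq V] (G : SimpleGraph V) [DecidableRel G.Adj]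

/-- **Two-copy odd-part pushforward, general test function** (`ℝ≥0∞`): under the pair weight
`1{∂n₁ = A} 1{∂n₂ = B} w_β(n₁) w_β(n₂)` the pair of odd parts `(odd n₁, odd n₂)` has the product
loop-O(1) law, `Σ_{(n₁,n₂)} w w · g(odd n₁, odd n₂) = Σ_{F₁ ∈ 𝒯(A)} Σ_{F₂ ∈ 𝒯(B)} s(F₁) s(F₂) g(F₁,F₂)` with
`s(F) = sinh(β)^{|F|} cosh(β)^{|E|−|F|}` (twice the one-copy lemma `tsum_sources_eweight_mul_apply_oddPart`;
the tree's `twoCopyPushforward` is the case of an indicator `g`). -/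
theorem pairTree_twoCopyPushforward {β : ℝ} (hβ : 0 ≤ β) (A B : Finset V)
    (g : Finset (Sym2 V) → Finset (Sym2 V) → ℝ≥0∞) :
    ∑' p : Current G × Current G,
        epairWeight (fun _ : G.edgeFinset => β) A B p *
          g ((univ.filter fun e : G.edgeFinset => Odd (p.1 e)).map (Function.Embedding.subtype _))
            ((univ.filter fun e : G.edgeFinset => Odd (p.2 e)).map (Function.Embedding.subtype _)) =
      ∑ F₁ ∈ tJoins G Set.univ A, ∑ F₂ ∈ tJoins G Set.univ B,
        ENNReal.ofReal (Real.sinh β ^ #F₁ * Real.cosh β ^ (#G.edgeFinset - #F₁)) *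
          (ENNReal.ofReal (Real.sinh β ^ #F₂ * Real.cosh β ^ (#G.edgeFinset - #F₂)) * g F₁ F₂) := by
  -- adapted from `FKParityRobustnessStrandsJoinBound.twoCopyPushforward` (steps 1–3)
  set oddP : Current G → Finset (Sym2 V) := fun n =>
    (univ.filter fun e : G.edgeFinset => Odd (n e)).map (Function.Embedding.subtype _) with hoddP
  set sc : Finset (Sym2 V) → ℝ≥0∞ := fun F =>
    ENNReal.ofReal (Real.sinh β ^ #F * Real.cosh β ^ (#G.edgeFinset - #F)) with hsc
  set H : Finset (Sym2 V) → ℝ≥0∞ := fun F₁ =>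
    ∑ F₂ ∈ G.edgeFinset.powerset,
      if (∀ v, Odd #(F₂.filter (v ∈ ·)) ↔ v ∈ B) then sc F₂ * g F₁ F₂ else 0 with hH
  have step1 : (∑' p : Current G × Current G,
        epairWeight (fun _ : G.edgeFinset => β) A B p * g (oddP p.1) (oddP p.2)) =
      ∑' n₁ : Current G, (if n₁.sources = A then n₁.eweight (fun _ : G.edgeFinset => β) else 0) *
        ∑' n₂ : Current G, (if n₂.sources = B then n₂.eweight (fun _ : G.edgeFinset => β) else 0) *
          g (oddP n₁) (oddP n₂) := by
    rw [ENNReal.tsum_prod']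
    refine tsum_congr fun n₁ => ?_
    rw [← ENNReal.tsum_mul_left]
    refine tsum_congr fun n₂ => ?_
    rw [epairWeight_eq_mul, mul_assoc]
  have step2 : ∀ n₁ : Current G,
      (∑' n₂ : Current G, (if n₂.sources = B then n₂.eweight (fun _ : G.edgeFinset => β) else 0) *
          g (oddP n₁) (oddP n₂)) = H (oddP n₁) := fun n₁ =>
    tsum_sources_eweight_mul_apply_oddPart hβ B (g (oddP n₁))
  have step3 : (∑' n₁ : Current G, (if n₁.sources = A then n₁.eweight (fun _ : G.edgeFinset => β) else 0) *
        H (oddP n₁)) =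
      ∑ F₁ ∈ G.edgeFinset.powerset,
        if (∀ v, Odd #(F₁.filter (v ∈ ·)) ↔ v ∈ A) then sc F₁ * H F₁ else 0 :=
    tsum_sources_eweight_mul_apply_oddPart hβ A H
  show (∑' p : Current G × Current G,
        epairWeight (fun _ : G.edgeFinset => β) A B p * g (oddP p.1) (oddP p.2)) = _
  rw [step1, tsum_congr fun n₁ => by rw [step2 n₁], step3,
    FKParityRobustnessStrandsJoinBound.tJoins_univ_eq_filter G A, Finset.sum_filter]
  refine Finset.sum_congr rfl fun F₁ _ => ?_
  by_cases hA : (∀ v, Odd #(F₁.filter (v ∈ ·)) ↔ v ∈ A)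
  · rw [if_pos hA, if_pos hA, hH]
    dsimp only
    rw [FKParityRobustnessStrandsJoinBound.tJoins_univ_eq_filter G B, Finset.sum_filter, Finset.mul_sum]
    refine Finset.sum_congr rfl fun F₂ _ => ?_
    split_ifs
    · rfl
    · rw [mul_zero]
  · rw [if_neg hA, if_neg hA]

/-- Joining inside the union of the two odd parts joins in the double current:
`x ↝_{odd n₁ ∪ odd n₂} u ⟹ u ∈ C_{n₁+n₂}(x)` (`odd nᵢ ⊆ trace(n₁ + n₂)`, `coe_oddPart_subset_traced_add`). -/
theorem pairTree_mem_cluster_of_rch_oddPart {x u : V} {p : Current G × Current G}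
    (h : rch (((univ.filter fun e : G.edgeFinset => Odd (p.1 e)).map (Function.Embedding.subtype _)) ∪
      ((univ.filter fun e : G.edgeFinset => Odd (p.2 e)).map (Function.Embedding.subtype _))) x u) :
    u ∈ (p.1 + p.2).cluster x := by
  have h1 := coe_oddPart_subset_traced_add p.1 p.2
  have h2 : (↑((univ.filter fun e : G.edgeFinset => Odd (p.2 e)).map
      (Function.Embedding.subtype _)) : Set (Sym2 V)) ⊆ (p.1 + p.2).traced := by
    rw [add_comm]
    exact coe_oddPart_subset_traced_add p.2 p.1
  have hle : SimpleGraph.fromEdgeSet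
        (↑(((univ.filter fun e : G.edgeFinset => Odd (p.1 e)).map (Function.Embedding.subtype _)) ∪
          ((univ.filter fun e : G.edgeFinset => Odd (p.2 e)).map (Function.Embedding.subtype _))) :
          Set (Sym2 V)) ≤
      Literature.Probability.Percolation.openGraph (p.1 + p.2).traced := by
    rw [Finset.coe_union]
    exact SimpleGraph.fromEdgeSet_mono (Set.union_subset h1 h2)
  exact Current.mem_cluster_iff.2 (h.mono hle)

/-- `tanh β ≥ 0` for `β ≥ 0`. -/
theorem pairTree_tanh_nonneg {β : ℝ} (hβ : 0 ≤ β) : 0 ≤ Real.tanh β := by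
  rw [Real.tanh_eq_sinh_div_cosh]
  exact div_nonneg (Real.sinh_nonneg_iff.2 hβ) (Real.cosh_pos β).le

/-- **Aizenman–Duminil-Copin 2021, Prop. A.3, in loop-O(1) clothes (the un-depleted pair attachment
bound).**  On every finite graph, for `β ≥ 0`, `t = tanh β`, `x ≠ y` and any two vertices `v, w`:
`Z^∅_t · Σ_{F ∈ 𝒯(xy)} Σ_{L ∈ 𝒯(∅)} t^{|F|+|L|} 1[x ↝_{F ∪ L} v ∧ x ↝_{F ∪ L} w] ≤ treePair G t x y v w`
`= Z(xv)Z(vw)Z(wy) + Z(xw)Z(wv)Z(vy)` (`Z(ab) = Z^{{a}∆{b}}_t`), i.e. after dividing by `Z^{xy}_t Z^∅_t`,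
`ℓ^{xy} ⊗ ℓ^∅[v, w ∈ C(x; F ∪ L)] ≤ [⟨σ_xσ_v⟩⟨σ_vσ_w⟩⟨σ_wσ_y⟩ + ⟨σ_xσ_w⟩⟨σ_wσ_v⟩⟨σ_vσ_y⟩]/⟨σ_xσ_y⟩`.
Proof: under `P^{xy} ⊗ P^∅` (random currents at coupling `β`) the pair of odd parts `(odd n₁, odd n₂)` has
the law `ℓ^{xy} ⊗ ℓ^∅` up to the factor `cosh(β)^{2|E|}` (`pairTree_twoCopyPushforward`), and
`F ∪ L = odd n₁ ∪ odd n₂ ⊆ trace(n₁ + n₂)`, so `C(x; F ∪ L) ⊆ 𝐂_{n₁+n₂}(x)` (`pairTree_mem_cluster_of_rch_oddPart`);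
the tree's Prop. A.3 `Z[∅]·Σ w w 1[v, w ∈ 𝐂_{n₁+n₂}(x)] ≤ Z[xw]Z[wv]Z[vy] + Z[xv]Z[vw]Z[wy]`
(`Current.ecurrentSum_empty_mul_tsum_double_conn_le`, `CurrentsPartialMonotonicity.lean`) and the dictionary
`Z_β[A] = cosh(β)^{|E|} Z^A_{tanh β}` (`ecurrentSum_eq_ofReal_loopO1`) conclude, the powers of `cosh β` cancelling. -/
theorem pairTree_loopPairSum_le_treePair {β : ℝ} (hβ : 0 ≤ β) {x y : V} (hxy : x ≠ y) (v w : V) :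
    loopO1PartitionFunction G (Real.tanh β) ∅ *
        ∑ F ∈ tJoins G Set.univ {x, y}, ∑ L ∈ tJoins G Set.univ ∅,
          (if rch (F ∪ L) x v ∧ rch (F ∪ L) x w then Real.tanh β ^ (#F + #L) else 0)
      ≤ treePair G (Real.tanh β) x y v w := by
  have ht : 0 ≤ Real.tanh β := pairTree_tanh_nonneg hβ
  have hc : 0 < Real.cosh β ^ #G.edgeFinset := pow_pos (Real.cosh_pos β) _
  have hK : ∀ _e : G.edgeFinset, 0 ≤ β := fun _ => hβ
  have hS : 0 ≤ ∑ F ∈ tJoins G Set.univ {x, y}, ∑ L ∈ tJoins G Set.univ ∅,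
      (if rch (F ∪ L) x v ∧ rch (F ∪ L) x w then Real.tanh β ^ (#F + #L) else 0) := by
    refine Finset.sum_nonneg fun F _ => Finset.sum_nonneg fun L _ => ?_
    split_ifs
    · exact pow_nonneg ht _
    · exact le_rfl
  -- (1) the pushforward of the pair indicator: `Σ w w g(odd n₁, odd n₂) = cosh^{2|E|} · S`
  have hpush : (∑' p : Current G × Current G,
      epairWeight (fun _ : G.edgeFinset => β) ({x} ∆ {y}) ∅ p *
        (if rch (((univ.filter fun e : G.edgeFinset => Odd (p.1 e)).map (Function.Embedding.subtype _)) ∪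
              ((univ.filter fun e : G.edgeFinset => Odd (p.2 e)).map (Function.Embedding.subtype _))) x v ∧
            rch (((univ.filter fun e : G.edgeFinset => Odd (p.1 e)).map (Function.Embedding.subtype _)) ∪
              ((univ.filter fun e : G.edgeFinset => Odd (p.2 e)).map (Function.Embedding.subtype _))) x w
          then (1 : ℝ≥0∞) else 0)) =
      ENNReal.ofReal ((Real.cosh β ^ #G.edgeFinset) ^ 2 *
        ∑ F ∈ tJoins G Set.univ {x, y}, ∑ L ∈ tJoins G Set.univ ∅,
          (if rch (F ∪ L) x v ∧ rch (F ∪ L) x w then Real.tanh β ^ (#F + #L) else 0)) := by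
    rw [pairTree_twoCopyPushforward G hβ ({x} ∆ {y}) ∅
      (fun F L => if rch (F ∪ L) x v ∧ rch (F ∪ L) x w then (1 : ℝ≥0∞) else 0),
      Current.symmDiff_singleton_eq_pair hxy, Finset.mul_sum,
      ENNReal.ofReal_sum_of_nonneg (fun F _ => by
        rw [Finset.mul_sum]
        refine Finset.sum_nonneg fun L _ => mul_nonneg (sq_nonneg _) ?_
        split_ifs
        · exact pow_nonneg ht _
        · exact le_rfl)]
    refine Finset.sum_congr rfl fun F hF => ?_
    rw [Finset.mul_sum, ENNReal.ofReal_sum_of_nonneg (fun L _ => by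
      refine mul_nonneg (sq_nonneg _) ?_
      split_ifs
      · exact pow_nonneg ht _
      · exact le_rfl)]
    refine Finset.sum_congr rfl fun L hL => ?_
    have hkF : #F ≤ #G.edgeFinset := Finset.card_le_card ((mem_tJoins G).1 hF).1
    have hkL : #L ≤ #G.edgeFinset := Finset.card_le_card ((mem_tJoins G).1 hL).1
    rw [sinh_pow_mul_cosh_pow_sub β hkF, sinh_pow_mul_cosh_pow_sub β hkL]
    by_cases hR : rch (F ∪ L) x v ∧ rch (F ∪ L) x w
    · rw [if_pos hR, if_pos hR, mul_one,
        ← ENNReal.ofReal_mul (mul_nonneg hc.le (pow_nonneg ht _))]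
      congr 1
      rw [pow_add]
      ring
    · rw [if_neg hR, if_neg hR, mul_zero, mul_zero, mul_zero, ENNReal.ofReal_zero]
  -- (2) inclusion in the double-current cluster, termwise
  have hmono : (∑' p : Current G × Current G,
      epairWeight (fun _ : G.edgeFinset => β) ({x} ∆ {y}) ∅ p *
        (if rch (((univ.filter fun e : G.edgeFinset => Odd (p.1 e)).map (Function.Embedding.subtype _)) ∪
              ((univ.filter fun e : G.edgeFinset => Odd (p.2 e)).map (Function.Embedding.subtype _))) x v ∧
            rch (((univ.filter fun e : G.edgeFinset => Odd (p.1 e)).map (Function.Embedding.subtype _)) ∪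
              ((univ.filter fun e : G.edgeFinset => Odd (p.2 e)).map (Function.Embedding.subtype _))) x w
          then (1 : ℝ≥0∞) else 0)) ≤
      ∑' p : Current G × Current G, epairWeight (fun _ : G.edgeFinset => β) ({x} ∆ {y}) ∅ p *
        ((if v ∈ (p.1 + p.2).cluster x then 1 else 0) * (if w ∈ (p.1 + p.2).cluster x then 1 else 0)) := by
    refine ENNReal.tsum_le_tsum fun p => mul_le_mul' le_rfl ?_
    split_ifs with hR h1 h2
    · rw [mul_one]
    · exact absurd (pairTree_mem_cluster_of_rch_oddPart G hR.2) h2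
    · exact absurd (pairTree_mem_cluster_of_rch_oddPart G hR.1) h1
    · exact absurd (pairTree_mem_cluster_of_rch_oddPart G hR.1) h1
    all_goals exact bot_le
  -- (3) Prop. A.3 for the double current `P^{xy} ⊗ P^∅`
  have hA3 := Current.ecurrentSum_empty_mul_tsum_double_conn_le (K := fun _ : G.edgeFinset => β) hK x y v w
  have hmain := (mul_le_mul' (le_refl (ecurrentSum (fun _ : G.edgeFinset => β) ∅)) hmono).trans hA3
  rw [hpush] at hmain
  -- (4) cast to `ℝ`: `Z_β[A] = cosh^{|E|} · Z^A_t`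
  have hZ : ∀ A : Finset V, (ecurrentSum (fun _ : G.edgeFinset => β) A).toReal =
      Real.cosh β ^ #G.edgeFinset * loopO1PartitionFunction G (Real.tanh β) A := fun A => by
    rw [FKParityRobustnessLatticeBoundFromStrands.ecurrentSum_eq_ofReal_loopO1 hβ A,
      ENNReal.toReal_ofReal (mul_nonneg hc.le (loopO1PartitionFunction_nonneg G ht A))]
  have hfin : ∀ A : Finset V, ecurrentSum (fun _ : G.edgeFinset => β) A ≠ ∞ :=
    fun A => ecurrentSum_ne_top hK A
  have hRfin : ecurrentSum (fun _ : G.edgeFinset => β) ({x} ∆ {w}) *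
        ecurrentSum (fun _ : G.edgeFinset => β) ({w} ∆ {v}) *
        ecurrentSum (fun _ : G.edgeFinset => β) ({v} ∆ {y}) +
      ecurrentSum (fun _ : G.edgeFinset => β) ({x} ∆ {v}) *
        ecurrentSum (fun _ : G.edgeFinset => β) ({v} ∆ {w}) *
        ecurrentSum (fun _ : G.edgeFinset => β) ({w} ∆ {y}) ≠ ∞ :=
    ENNReal.add_ne_top.2 ⟨ENNReal.mul_ne_top (ENNReal.mul_ne_top (hfin _) (hfin _)) (hfin _),
      ENNReal.mul_ne_top (ENNReal.mul_ne_top (hfin _) (hfin _)) (hfin _)⟩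
  have hreal := ENNReal.toReal_mono hRfin hmain
  rw [ENNReal.toReal_add (ENNReal.mul_ne_top (ENNReal.mul_ne_top (hfin _) (hfin _)) (hfin _))
    (ENNReal.mul_ne_top (ENNReal.mul_ne_top (hfin _) (hfin _)) (hfin _))] at hreal
  simp only [ENNReal.toReal_mul, hZ, ENNReal.toReal_ofReal (mul_nonneg (sq_nonneg _) hS)] at hreal
  -- (5) cancel `cosh(β)^{3|E|}`
  have key : (Real.cosh β ^ #G.edgeFinset) ^ 3 * (loopO1PartitionFunction G (Real.tanh β) ∅ *
      ∑ F ∈ tJoins G Set.univ {x, y}, ∑ L ∈ tJoins G Set.univ ∅,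
        (if rch (F ∪ L) x v ∧ rch (F ∪ L) x w then Real.tanh β ^ (#F + #L) else 0)) ≤
      (Real.cosh β ^ #G.edgeFinset) ^ 3 * treePair G (Real.tanh β) x y v w := by
    unfold treePair zPair
    calc (Real.cosh β ^ #G.edgeFinset) ^ 3 * (loopO1PartitionFunction G (Real.tanh β) ∅ *
          ∑ F ∈ tJoins G Set.univ {x, y}, ∑ L ∈ tJoins G Set.univ ∅,
            (if rch (F ∪ L) x v ∧ rch (F ∪ L) x w then Real.tanh β ^ (#F + #L) else 0))
        = Real.cosh β ^ #G.edgeFinset * loopO1PartitionFunction G (Real.tanh β) ∅ *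
            ((Real.cosh β ^ #G.edgeFinset) ^ 2 *
              ∑ F ∈ tJoins G Set.univ {x, y}, ∑ L ∈ tJoins G Set.univ ∅,
                (if rch (F ∪ L) x v ∧ rch (F ∪ L) x w then Real.tanh β ^ (#F + #L) else 0)) := by ring
      _ ≤ _ := hreal
      _ = _ := by ring
  exact le_of_mul_le_mul_left key (pow_pos hc 3)

end StubCrossPairTree


/-! ### The bound, top level -/

open Summit.CriticalPhenomena.Ising3DConformalLimit.Cruxes.IndependentStrandsJoin.CrossFatteningDecoupling in
/-- **Step (iii) of `stub_crossPairTree`: the un-depleted pair connection of `ℓ^{xy} ⊗ ℓ^∅` is bounded by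
the Aizenman–Duminil-Copin tree** (ADC2021 Prop. A.3 transported to loop O(1)).  On every finite graph, for
`β ≥ 0`, `t = tanh β`, `x ≠ y` and all `v, w`:
`Z^∅_t · Σ_{F ∈ 𝒯(xy)} Σ_{L ∈ 𝒯(∅)} t^{|F|+|L|} 1[x ↝_{F∪L} v ∧ x ↝_{F∪L} w] ≤ treePair G t x y v w`.
This is `StubCrossPairTree.pairTree_loopPairSum_le_treePair`; registered as the auxiliary stub
`stub_crossPairTreeBound` of crux stmt-CriticalPhenomena-14625 (signature verbatim). -/
theorem stub_crossPairTreeBound :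
    ∀ (V : Type) [Fintype V] [DecidableEq V] (G : SimpleGraph V) [DecidableRel G.Adj] (β : ℝ), 0 ≤ β →
      ∀ (x y v w : V), x ≠ y →
      loopO1PartitionFunction G (Real.tanh β) ∅ *
          ∑ F ∈ tJoins G Set.univ {x, y}, ∑ L ∈ tJoins G Set.univ ∅,
            (if rch (F ∪ L) x v ∧ rch (F ∪ L) x w then Real.tanh β ^ (#F + #L) else 0)
        ≤ treePair G (Real.tanh β) x y v w :=
  fun _ _ _ G _ _ hβ _ _ v w hxy => StubCrossPairTree.pairTree_loopPairSum_le_treePair G hβ hxy v w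

end Summit.CriticalPhenomena.Ising3DConformalLimit.Theorems

end
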